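/-
Copyright (c) 2026 the pub-hodgecm-mathlib formalisation cell (harness21).  Prover seat hodgecm-mathlib-F0P2-p02 (g11): road «S3-tree», the LIFT `_le_one ↦ _le_two`, organ (I)
`stub_liftInterior` split A-139 (architect A-p16 (g30)): N5a «`u_H → 1`» (matrix half), 2026-09-01.
-/
import Literature.NumberTheory.Automorphic.TypeTwoMoebiusShiftValued         -- ★ γ₁ F0P2-p06 (g10): `shift_parameter_facts`; brings ★ α `MatrixMoebiusShift`
import HarnessLib

/-!
# The Cayley shift near the identity, matrix half: a level-`(j+1)` element shifts to a level-`j` element (Kottwitz 1986 §3; Rogawski 1990 §4.9)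

Topic `NumberTheory/Automorphic` (companion of ★ γ₁ `TypeTwoMoebiusShiftValued` and ★ `MatrixMoebiusShiftInverse`); namespace `Literature.NumberTheory.Automorphic.MoebiusShift`
(valued-field lemmas).  THEOREMS ONLY (no definition, no instance, no notation, no named fact, no `sorry`); kernel lane `--supports stmt-HodgeConjecture-24833`.
Cell `pub/hodgecm-mathlib` (D-0151), crux H413; road «S3-tree», the LIFT `_le_one ↦ _le_two`, organ (I) `stub_liftInterior` (fold `LocalTransferAtOneHyperspecialLevelTwo`
v3.2 :482), split A-139 (architect A-p16 (g30)): this file is **N5a**, the matrix half of N5 «`u_H → 1`» (the binder `uH ∈ V′` of (I)).  The carrier half N5b — «for every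
`V′ ∈ 𝓝 1` of `H_v` there is `j ≥ 1` such that the shift of every level-`(j+1)` `γ_H` lies in `V′`», by ★ `exists_congruenceGL_subset` (congruence subgroups are a basis of
`𝓝 1` in `GL_n(L_w)`, `GLnCongruenceSubgroups`) read through the one-place models ★ `localNonsplitEquiv` — consumes exactly the two level lemmas below and is the next
file (`Rogawski1990/CayleyShiftNhdsOneCM`).  HONEST LABEL: HC_CM is proved only modulo the 2 remaining named inputs (hLiu418 24832, h413 24833) until rung 0 closes; nothing
printed is asserted here.

THE MATHEMATICS.  `K` a valued field, `|c| = exp(−1)`, `|2| = 1`, `φ_c(g) = ((c+1)g + (c−1))((c−1)g + (c+1))⁻¹`.  If `g ≡ 1 (mod c^{j+1})` entrywise (`2 × 2`, `j ≥ 1`) then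
`φ_c(g) ≡ 1` and `φ_c(g)⁻¹ ≡ 1 (mod c^j)` entrywise: with `E = g − 1` the denominator is `D = 2c·1 + (c−1)E`, `|det D| = exp(−2)`, `|(D⁻¹)_{ab}| ≤ exp(1)` (adjugate), and
`φ_c(g) − 1 = 2E·D⁻¹`, `φ_c(g)⁻¹ − 1 = −2E·N⁻¹` (`N = 2c·1 + (c+1)E`).  Scalar twin: `u ≡ 1 (mod c^{j+1})` ⇒ `φ_c(u) ≡ 1`, `φ_c(u)⁻¹ ≡ 1 (mod c^j)`.  So the shift `u_H`
of a deep `γ_H` is as close to `1` as wanted: one level is lost, no more.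

## References
* [Kottwitz1986] R. E. Kottwitz, *Base change for unit elements of Hecke algebras*, Compositio Math. 60 (1986), §3.
* [Rogawski1990] J. D. Rogawski, *Automorphic Representations of Unitary Groups in Three Variables*, Ann. of Math. Stud. 123 (1990), §4.9 Prop. 4.9.1 (a)(b) p. 55.
* [SerreLocalFields1979] J.-P. Serre, *Local Fields*, GTM 67 (1979), Ch. I §§1–2.
-/

set_option autoImplicit false

noncomputable section

open Matrix Polynomial
open scoped WithZero

/-! ## §1 A level-`(j+1)` element shifts to a level-`j` element (valued field) -/

namespace Literature.NumberTheory.Automorphic.MoebiusShift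

section Level

variable {K : Type*} [Field K] [Valued K ℤᵐ⁰]

/-- Powers of `|c| = exp(−1)`: `|c|^n = exp(−n)`. [cite: SerreLocalFields1979, Ch. I §§1–2] -/
theorem valued_pow_of_valued_eq_exp_neg_one {c : K} (hc : Valued.v c = WithZero.exp (-1 : ℤ)) (n : ℕ) :
    Valued.v c ^ n = WithZero.exp (-(n : ℤ)) := by
  rw [hc, ← WithZero.exp_nsmul]; congr 1; simp

/-- **The denominator near `1`**: for `M = 2c·1 + t·E` (`2 × 2`, `|t| ≤ 1`, `|E_{ab}| ≤ |c|^{j+1}`, `j ≥ 1`, `|c| = exp(−1)`, `|2| = 1`): `|det M| = exp(−2)` and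
`|(M⁻¹)_{ab}| ≤ exp(1)` (adjugate formula). [cite: Kottwitz1986, §3] [cite: SerreLocalFields1979, Ch. I §§1–2] -/
theorem valued_det_and_inv_two_c_add (h2 : Valued.v (2 : K) = 1) {c : K} (hc : Valued.v c = WithZero.exp (-1 : ℤ)) {t : K} (ht : Valued.v t ≤ 1)
    {E : Matrix (Fin 2) (Fin 2) K} {j : ℕ} (hj : 1 ≤ j) (hE : ∀ a b, Valued.v (E a b) ≤ Valued.v c ^ (j + 1)) :
    Valued.v (((2 * c) • (1 : Matrix (Fin 2) (Fin 2) K) + t • E).det) = WithZero.exp (-2 : ℤ) ∧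
      ∀ a b, Valued.v ((((2 * c) • (1 : Matrix (Fin 2) (Fin 2) K) + t • E)⁻¹) a b) ≤ WithZero.exp (1 : ℤ) := by
  set M : Matrix (Fin 2) (Fin 2) K := (2 * c) • (1 : Matrix (Fin 2) (Fin 2) K) + t • E with hM
  have h2c : Valued.v (2 * c) = WithZero.exp (-1 : ℤ) := by rw [map_mul, h2, one_mul, hc]
  have hcpow := valued_pow_of_valued_eq_exp_neg_one hc (j + 1)
  have hsmall : ∀ a b, Valued.v (t * E a b) < WithZero.exp (-1 : ℤ) := fun a b => by
    rw [map_mul]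
    calc Valued.v t * Valued.v (E a b) ≤ 1 * Valued.v c ^ (j + 1) := mul_le_mul' ht (hE a b)
      _ = WithZero.exp (-((j + 1 : ℕ) : ℤ)) := by rw [one_mul, hcpow]
      _ < WithZero.exp (-1 : ℤ) := by rw [WithZero.exp_lt_exp]; omega
  have hdiag : ∀ a, Valued.v (M a a) = WithZero.exp (-1 : ℤ) := fun a => by
    have e : M a a = 2 * c + t * E a a := by simp [hM, Matrix.add_apply, Matrix.smul_apply, Matrix.one_apply_eq]
    rw [e, Valuation.map_add_eq_of_lt_left _ (by rw [h2c]; exact hsmall a a), h2c]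
  have hoff : ∀ a b, a ≠ b → Valued.v (M a b) < WithZero.exp (-1 : ℤ) := fun a b hab => by
    have e : M a b = t * E a b := by simp [hM, Matrix.add_apply, Matrix.smul_apply, Matrix.one_apply_ne hab]
    rw [e]; exact hsmall a b
  have hall : ∀ a b, Valued.v (M a b) ≤ WithZero.exp (-1 : ℤ) := fun a b => by
    by_cases hab : a = b
    · subst hab; exact (hdiag a).le
    · exact (hoff a b hab).le
  -- the determinant
  have hdet : Valued.v M.det = WithZero.exp (-2 : ℤ) := by
    rw [Matrix.det_fin_two]
    have hmain : Valued.v (M 0 0 * M 1 1) = WithZero.exp (-2 : ℤ) := by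
      rw [map_mul, hdiag, hdiag, ← WithZero.exp_add]; norm_num
    have hsub : Valued.v (M 0 1 * M 1 0) < Valued.v (M 0 0 * M 1 1) := by
      rw [hmain, map_mul, mul_comm]
      calc Valued.v (M 1 0) * Valued.v (M 0 1) < WithZero.exp (-1 : ℤ) * WithZero.exp (-1 : ℤ) :=
            mul_lt_mul_of_le_of_lt_of_nonneg_of_pos (hall 1 0) (hoff 0 1 (by decide)) zero_le (zero_lt_iff.2 WithZero.exp_ne_zero)
        _ = WithZero.exp (-2 : ℤ) := by rw [← WithZero.exp_add]; norm_num
    rw [Valuation.map_sub_eq_of_lt_left _ hsub, hmain]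
  refine ⟨hdet, fun a b => ?_⟩
  have hdet0 : M.det ≠ 0 := fun h => by rw [h, map_zero] at hdet; exact WithZero.zero_ne_coe hdet
  have hadj : ∀ a b, Valued.v (M.adjugate a b) ≤ WithZero.exp (-1 : ℤ) := fun a b => by
    rw [Matrix.adjugate_fin_two]
    fin_cases a <;> fin_cases b
    · simpa using hall 1 1
    · simpa using hall 0 1
    · simpa using hall 1 0
    · simpa using hall 0 0
  rw [Matrix.inv_def, Matrix.smul_apply, smul_eq_mul, Ring.inverse_eq_inv', map_mul, map_inv₀, hdet, ← WithZero.exp_neg, neg_neg]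
  calc WithZero.exp (2 : ℤ) * Valued.v (M.adjugate a b) ≤ WithZero.exp (2 : ℤ) * WithZero.exp (-1 : ℤ) := mul_le_mul' le_rfl (hadj a b)
    _ = WithZero.exp (1 : ℤ) := by rw [← WithZero.exp_add]; norm_num

/-- **A LEVEL-`(j+1)` ELEMENT SHIFTS TO A LEVEL-`j` ELEMENT** (`2 × 2`): `g ≡ 1 (mod c^{j+1})` entrywise, `j ≥ 1` ⇒ `φ_c(g) − 1 ≡ 0` and `φ_c(g)⁻¹ − 1 ≡ 0 (mod c^j)`
entrywise (`φ_c(g) − 1 = 2(g−1)·D⁻¹`, `φ_c(g)⁻¹ − 1 = −2(g−1)·N⁻¹`). [cite: Kottwitz1986, §3] [cite: Rogawski1990, §4.9 Prop. 4.9.1 (b) p. 55] -/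
theorem valued_moebius_sub_one_le_of_level (h2 : Valued.v (2 : K) = 1) {c : K} (hc : Valued.v c = WithZero.exp (-1 : ℤ))
    (g : Matrix (Fin 2) (Fin 2) K) {j : ℕ} (hj : 1 ≤ j) (hg : ∀ a b, Valued.v ((g - 1) a b) ≤ Valued.v c ^ (j + 1)) :
    (∀ a b, Valued.v ((((c + 1) • g + (c - 1) • (1 : Matrix (Fin 2) (Fin 2) K)) * ((c - 1) • g + (c + 1) • (1 : Matrix (Fin 2) (Fin 2) K))⁻¹ - 1) a b) ≤
        Valued.v c ^ j) ∧
      ∀ a b, Valued.v (((((c + 1) • g + (c - 1) • (1 : Matrix (Fin 2) (Fin 2) K)) * ((c - 1) • g + (c + 1) • (1 : Matrix (Fin 2) (Fin 2) K))⁻¹)⁻¹ - 1) a b) ≤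
        Valued.v c ^ j := by
  obtain ⟨-, -, hcm, hcp, -, -⟩ := shift_parameter_facts hc
  set E : Matrix (Fin 2) (Fin 2) K := g - 1 with hE
  have hgE : g = 1 + E := by rw [hE, add_sub_cancel]
  -- the two denominators in the `2c·1 + t·E` form
  have hD : (c - 1) • g + (c + 1) • (1 : Matrix (Fin 2) (Fin 2) K) = (2 * c) • (1 : Matrix (Fin 2) (Fin 2) K) + (c - 1) • E := by rw [hgE]; module
  have hN : (c + 1) • g + (c - 1) • (1 : Matrix (Fin 2) (Fin 2) K) = (2 * c) • (1 : Matrix (Fin 2) (Fin 2) K) + (c + 1) • E := by rw [hgE]; module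
  obtain ⟨hdetD, hinvD⟩ := valued_det_and_inv_two_c_add h2 hc hcm.le hj hg
  obtain ⟨hdetN, hinvN⟩ := valued_det_and_inv_two_c_add h2 hc hcp.le hj hg
  rw [hD, hN]
  set D : Matrix (Fin 2) (Fin 2) K := (2 * c) • (1 : Matrix (Fin 2) (Fin 2) K) + (c - 1) • E with hDdef
  set N : Matrix (Fin 2) (Fin 2) K := (2 * c) • (1 : Matrix (Fin 2) (Fin 2) K) + (c + 1) • E with hNdef
  have hDu : IsUnit D.det := isUnit_iff_ne_zero.2 fun h => by rw [h, map_zero] at hdetD; exact WithZero.zero_ne_coe hdetD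
  have hNu : IsUnit N.det := isUnit_iff_ne_zero.2 fun h => by rw [h, map_zero] at hdetN; exact WithZero.zero_ne_coe hdetN
  have hNsubD : N - D = (2 : K) • E := by rw [hNdef, hDdef]; module
  have hcpow := valued_pow_of_valued_eq_exp_neg_one hc
  -- entry bound for `(2•E) * M⁻¹`
  have hbound : ∀ {Mi : Matrix (Fin 2) (Fin 2) K}, (∀ a b, Valued.v (Mi a b) ≤ WithZero.exp (1 : ℤ)) →
      ∀ a b, Valued.v ((((2 : K) • E) * Mi) a b) ≤ Valued.v c ^ j := by
    intro Mi hMi a b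
    rw [Matrix.mul_apply]
    refine Valuation.map_sum_le _ fun k _ => ?_
    rw [Matrix.smul_apply, smul_eq_mul, map_mul, map_mul, h2, one_mul, hcpow j]
    calc Valued.v (E a k) * Valued.v (Mi k b) ≤ Valued.v c ^ (j + 1) * WithZero.exp (1 : ℤ) := mul_le_mul' (hg a k) (hMi k b)
      _ = WithZero.exp (-(j : ℤ)) := by rw [hcpow (j + 1), ← WithZero.exp_add]; congr 1; push_cast; ring
  refine ⟨fun a b => ?_, fun a b => ?_⟩
  · -- `φ(g) − 1 = (N − D) D⁻¹`
    have e : N * D⁻¹ - 1 = ((2 : K) • E) * D⁻¹ := by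
      rw [← hNsubD, sub_mul, Matrix.mul_nonsing_inv D hDu]
    rw [e]
    exact hbound hinvD a b
  · -- `φ(g)⁻¹ − 1 = (D − N) N⁻¹`
    have e : (N * D⁻¹)⁻¹ - 1 = -(((2 : K) • E) * N⁻¹) := by
      rw [Matrix.mul_inv_rev, Matrix.nonsing_inv_nonsing_inv D hDu, ← hNsubD, ← neg_mul, neg_sub, sub_mul, Matrix.mul_nonsing_inv N hNu]
    rw [e, Matrix.neg_apply, Valuation.map_neg]
    exact hbound hinvN a b

/-- **The scalar twin**: `u ≡ 1 (mod c^{j+1})`, `j ≥ 1` ⇒ `φ_c(u) − 1 ≡ 0` and `φ_c(u)⁻¹ − 1 ≡ 0 (mod c^j)`, `φ_c(u) = ((c+1)u + (c−1))∕((c−1)u + (c+1))`.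
[cite: Kottwitz1986, §3] -/
theorem valued_moebius_scalar_sub_one_le_of_level (h2 : Valued.v (2 : K) = 1) {c : K} (hc : Valued.v c = WithZero.exp (-1 : ℤ))
    (u : K) {j : ℕ} (hj : 1 ≤ j) (hu : Valued.v (u - 1) ≤ Valued.v c ^ (j + 1)) :
    Valued.v (((c + 1) * u + (c - 1)) / ((c - 1) * u + (c + 1)) - 1) ≤ Valued.v c ^ j ∧
      Valued.v ((((c + 1) * u + (c - 1)) / ((c - 1) * u + (c + 1)))⁻¹ - 1) ≤ Valued.v c ^ j := by
  obtain ⟨-, -, hcm, hcp, -, -⟩ := shift_parameter_facts hc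
  have h2c : Valued.v (2 * c) = WithZero.exp (-1 : ℤ) := by rw [map_mul, h2, one_mul, hc]
  have hcpow := valued_pow_of_valued_eq_exp_neg_one hc
  have hsmall : ∀ {t : K}, Valued.v t = 1 → Valued.v (t * (u - 1)) < Valued.v (2 * c) := fun {t} ht => by
    rw [map_mul, ht, one_mul, h2c]
    calc Valued.v (u - 1) ≤ Valued.v c ^ (j + 1) := hu
      _ = WithZero.exp (-((j + 1 : ℕ) : ℤ)) := hcpow (j + 1)
      _ < WithZero.exp (-1 : ℤ) := by rw [WithZero.exp_lt_exp]; omega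
  have eD : (c - 1) * u + (c + 1) = 2 * c + (c - 1) * (u - 1) := by ring
  have eN : (c + 1) * u + (c - 1) = 2 * c + (c + 1) * (u - 1) := by ring
  have hD : Valued.v ((c - 1) * u + (c + 1)) = WithZero.exp (-1 : ℤ) := by rw [eD, Valuation.map_add_eq_of_lt_left _ (hsmall hcm), h2c]
  have hN : Valued.v ((c + 1) * u + (c - 1)) = WithZero.exp (-1 : ℤ) := by rw [eN, Valuation.map_add_eq_of_lt_left _ (hsmall hcp), h2c]
  have hD0 : (c - 1) * u + (c + 1) ≠ 0 := fun h => by rw [h, map_zero] at hD; exact WithZero.zero_ne_coe hD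
  have hN0 : (c + 1) * u + (c - 1) ≠ 0 := fun h => by rw [h, map_zero] at hN; exact WithZero.zero_ne_coe hN
  have hfin : ∀ {d : K}, Valued.v d = WithZero.exp (-1 : ℤ) → Valued.v (2 * (u - 1) / d) ≤ Valued.v c ^ j := fun {d} hd => by
    rw [map_div₀, map_mul, h2, one_mul, hd, div_eq_mul_inv, ← WithZero.exp_neg, neg_neg, hcpow j]
    calc Valued.v (u - 1) * WithZero.exp (1 : ℤ) ≤ Valued.v c ^ (j + 1) * WithZero.exp (1 : ℤ) := mul_le_mul' hu le_rfl
      _ = WithZero.exp (-(j : ℤ)) := by rw [hcpow (j + 1), ← WithZero.exp_add]; congr 1; push_cast; ring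
  refine ⟨?_, ?_⟩
  · have e : ((c + 1) * u + (c - 1)) / ((c - 1) * u + (c + 1)) - 1 = 2 * (u - 1) / ((c - 1) * u + (c + 1)) := by
      rw [div_sub_one hD0]; congr 1; ring
    rw [e]; exact hfin hD
  · have e : (((c + 1) * u + (c - 1)) / ((c - 1) * u + (c + 1)))⁻¹ - 1 = -(2 * (u - 1) / ((c + 1) * u + (c - 1))) := by
      rw [inv_div, div_sub_one hN0, ← neg_div]; congr 1; ring
    rw [e, Valuation.map_neg]; exact hfin hN

end Level

end Literature.NumberTheory.Automorphic.MoebiusShift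

end
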